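import Summits.NavierStokesRegularity.FluidComputer.ClayBlowupLerayRate
import Literature.Analysis.FluidPDE.NSVorticityBKMHolds
import Literature.Analysis.FluidPDE.ConstantinFeffermanHolds
import Literature.Analysis.FluidPDE.GradientRegularityCriteriaProofs
import Literature.Analysis.FluidPDE.MillerMiddleEigenvalueCriterionProofs
import HarnessLib

/-!
# THE VORTICITY ROWS OF AN UNFORCED CLAY BLOW-UP: Beale–Kato–Majda, Constantin–Fefferman,
# Beirão da Veiga's gradient scale and Miller's middle eigenvalue — all kernel, by name on the type

Cell `ns-blowup`, seat `ns-blowup-ecbridge-2` (g8; the E–C endpoint theory seat). LABEL: E–C typing,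
(A)-side (KERNEL — no named fact). WHAT THIS IS NOT: not Navier–Stokes evidence — necessary conditions on
the UNFORCED inhabitants of `ClayBlowup ν` / `DesignedBlowup ν` (exactly the counterexamples to
Fefferman's (A), `exists_unforced_clayBlowup_of_not_navierStokesRegularity`); no inhabitant is claimed.
Companion memo: `run/shared/lean/pub/ns-blowup/ecbridge2/ECBRIDGE-2-MEMO-7.md`.

## Content

The tree PROVES the four classical vorticity/strain blow-up criteria for classical unforced solutions
in the BKM class (`beale_kato_majda_holds`, `constantin_fefferman_holds`,
`BeiraoDaVeiga1995_gradientCriterion_holds`, `Miller2019.middleEigenvalueCriterion_holds`). An unforced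
Clay blow-up is in that class on every closed sub-slab (`hasBoundedSobolevNormsOn`, Tao's class), is
maximal (`not_hasSmoothExtensionPast`, g6) and has a maximal Leray–Hopf completion from its Clay datum
(`exists_maximal_lerayHopf`, g8). Hence, for every `X : ClayBlowup ν` with `X.f = 0` (`ν > 0`):

* **`ClayBlowup.lintegral_vorticity_sup_eq_top`** — BKM: `∫₀ᵀ ‖ω(t)‖_{L^∞} dt = ∞`;
* **`ClayBlowup.vorticityDirection_incoherent`** — Constantin–Fefferman: for EVERY threshold `Ω > 0`
  and EVERY length `ρ > 0` there are a time `t < T` and points `x, y` in the high-vorticity region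
  `{|ω(t, ·)| > Ω}` where the vorticity directions `ξ = ω/|ω|` make an angle with
  `|sin ∠(ξ(x), ξ(y))| > |x − y|/ρ`: the direction field is not uniformly Lipschitz on the
  high-vorticity regions up to the blow-up time;
* **`ClayBlowup.gradient_not_memLqLp`** — Beirão da Veiga: `∇u ∉ L^q_t L^r_x((0, T) × ℝ³)` for every
  `1 < q < ∞`, `2/q + 3/r = 2` (e.g. `∇u ∉ L²_t L³_x`, `∇u ∉ L⁴_t L²_x`-scale …);
* **`ClayBlowup.middleEigenvalue_not_integrable`** — Miller: no nonnegative majorant `m` of the strain's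
  quadratic form on a (pointwise chosen) 2-plane — i.e. of the middle eigenvalue `λ₂⁺` of
  `½(∇u + ∇uᵀ)` — lies in `L^p_t L^q_x`, `2/p + 3/q = 2`, `q > 3/2`: blow-up needs genuinely
  TWO-DIRECTIONAL stretching, not integrable in this scale;
* the `DesignedBlowup` twins.

References: J. T. Beale, T. Kato, A. Majda, Comm. Math. Phys. 94 (1984), Thm. 1
[cite: BealeKatoMajda1984, Theorem 1]; P. Constantin, C. Fefferman, Indiana Univ. Math. J. 42 (1993), §1
[cite: ConstantinFeffermanIndiana1993, Theorem (§1)]; H. Beirão da Veiga, Chinese Ann. Math. B 16 (1995) /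
L. C. Berselli, G. P. Galdi, PAMS 130 (2002) (1.3) [cite: BerselliGaldi2002, (1.3) p. 3586]; E. Miller,
Arch. Ration. Mech. Anal. 237 (2020) = arXiv 2019, Thm. 1.1 [cite: Miller2019, Thm 1.1]; C. L. Fefferman,
Clay problem description, (A) [cite: FeffermanClay2006, (A)].
-/

noncomputable section

namespace Summit.NavierStokesRegularity.FluidComputer

open Set MeasureTheory Filter Topology Function Metric
open scoped ENNReal ContDiff NNReal
open Literature.Analysis.FluidPDE
open Summit.NavierStokesRegularity.NavierStokesRegularity

namespace ClayBlowup

variable {ν : ℝ} (X : ClayBlowup ν)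

/-! ## §1 The BKM class and maximality in the BKM vocabulary -/

/-- **A Clay blow-up is in the Beale–Kato–Majda class on every `[0, T'']`, `T'' < T`** (all `L²`
Sobolev norms of `u(t)` bounded; `ν > 0`): Tao's class on `[0, max T'' (T/2)]` (`hasBoundedSobolevNormsOn`)
restricted. [cite: Tao2011, Cor. 11.1] -/
theorem hasBoundedSobolevNormsOn_of_lt (hν : 0 < ν) :
    ∀ T'' < X.T, HasBoundedSobolevNormsOn (Icc 0 T'') X.u := by
  intro T'' hT''
  have hT := X.T_pos
  have h1 : 0 < max T'' (X.T / 2) := lt_max_of_lt_right (half_pos hT)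
  have h2 : max T'' (X.T / 2) < X.T := max_lt hT'' (half_lt_self hT)
  exact (X.hasBoundedSobolevNormsOn hν h1 h2).mono (Icc_subset_Icc_right (le_max_left _ _))

/-- **An unforced Clay blow-up has no continuation in the BKM class past `T`**
(`HasSobolevExtensionPast` would be a classical continuation, `not_hasSmoothExtensionPast`).
[cite: BealeKatoMajda1984, §1] -/
theorem not_hasSobolevExtensionPast (hν : 0 < ν) (hf : X.f = 0) :
    ¬ HasSobolevExtensionPast ν X.u X.T := by
  intro h
  have h' : HasSmoothExtensionPast ν X.f X.u X.T := by
    rw [hf]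
    exact h.hasSmoothExtensionPast
  exact X.not_hasSmoothExtensionPast hν h'

/-- The unforced classical system on `[0, T)` (the field `classical` with `f = 0` substituted).
[folklore] -/
theorem classical_zero (hf : X.f = 0) : IsClassicalNSSolutionOn (Ico 0 X.T) ν 0 X.u X.p := by
  have h := X.classical
  rw [hf] at h
  exact h

/-! ## §2 Beale–Kato–Majda -/

/-- **BEALE–KATO–MAJDA FOR EVERY UNFORCED CLAY BLOW-UP** (`ν > 0`, `f = 0`; no named fact):
`∫₀ᵀ ‖curl u(t)‖_{L^∞} dt = ∞` (lower Lebesgue integral of the `ℝ≥0∞`-valued spatial supremum). The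
tree theorem `beale_kato_majda_holds` (continuation in the BKM class iff the integral is finite) and
`not_hasSobolevExtensionPast`. [cite: BealeKatoMajda1984, Theorem 1] -/
theorem lintegral_vorticity_sup_eq_top (hν : 0 < ν) (hf : X.f = 0) :
    (∫⁻ t in Ioo 0 X.T, ⨆ x, ‖curl (X.u t) x‖ₑ) = ⊤ := by
  by_contra hne
  exact X.not_hasSobolevExtensionPast hν hf
    ((beale_kato_majda_holds hν.le X.T_pos (X.classical_zero hf)
      (X.hasBoundedSobolevNormsOn_of_lt hν)).2 (lt_top_iff_ne_top.2 hne))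

/-! ## §3 Constantin–Fefferman -/

/-- **CONSTANTIN–FEFFERMAN FOR EVERY UNFORCED CLAY BLOW-UP: the vorticity direction is incoherent in
the high-vorticity region** (`ν > 0`, `f = 0`; no named fact). For every `Ω > 0` and `ρ > 0` there are
`t ∈ [0, T)` and points `x, y` with `|ω(t, x)| > Ω`, `|ω(t, y)| > Ω` and
`√(1 − ⟪ξ(t,x), ξ(t,y)⟫²) > |x − y|/ρ`, `ξ = ω/|ω|` (`vorticityDirection`): the sine of the angle between
vorticity directions is NOT `ρ⁻¹`-Lipschitz on `{|ω| > Ω}` uniformly up to `T`. The tree theorem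
`constantin_fefferman_holds` (coherence ⇒ continuation in the BKM class) and `not_hasSobolevExtensionPast`.
[cite: ConstantinFeffermanIndiana1993, Theorem (§1)] -/
theorem vorticityDirection_incoherent (hν : 0 < ν) (hf : X.f = 0) {Ω ρ : ℝ} (hΩ : 0 < Ω)
    (hρ : 0 < ρ) :
    ∃ t ∈ Ico 0 X.T, ∃ x y : EuclideanSpace ℝ (Fin 3),
      Ω < ‖curl (X.u t) x‖ ∧ Ω < ‖curl (X.u t) y‖ ∧
        ‖x - y‖ / ρ <
          Real.sqrt (1 - inner ℝ (vorticityDirection (curl (X.u t)) x)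
            (vorticityDirection (curl (X.u t)) y) ^ 2) := by
  by_contra h
  push Not at h
  exact X.not_hasSobolevExtensionPast hν hf
    (constantin_fefferman_holds hν X.T_pos hΩ hρ (X.classical_zero hf)
      (X.hasBoundedSobolevNormsOn_of_lt hν) fun t ht x y hx hy => h t ht x y hx hy)

/-! ## §4 Beirão da Veiga's gradient scale -/

/-- **BEIRÃO DA VEIGA FOR EVERY UNFORCED CLAY BLOW-UP: `∇u ∉ L^q_t L^r_x((0,T) × ℝ³)` whenever
`1 < q < ∞`, `2/q + 3/r = 2`** (`ν > 0`, `f = 0`; no named fact). The tree theorem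
`BeiraoDaVeiga1995_gradientCriterion_holds` applied to the maximal Leray–Hopf completion
(`exists_maximal_lerayHopf`: `v = u` on `[0, T)`, Leray–Hopf on `[0, T]` from the Clay datum), whose
gradient has the same mixed norms on `(0, T)` (`MemLqLp.congr_ae_slice`).
[cite: BerselliGaldi2002, (1.3) p. 3586] -/
theorem gradient_not_memLqLp (hν : 0 < ν) (hf : X.f = 0) {q r : ℝ≥0∞} (h1q : 1 < q) (hq : q < ⊤)
    (hqr : 2 / q + 3 / r = 2) :
    ¬ MemLqLp q r (fun t x => fderiv ℝ (X.u t) x) (Ioo 0 X.T) := by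
  intro hmem
  obtain ⟨v, hvu, hmax, hLH⟩ := X.exists_maximal_lerayHopf hν hf
  have hv0 : v 0 = X.u 0 := hvu 0 ⟨le_rfl, X.T_pos⟩
  have hdec : HasRapidSpatialDecay (v 0) := by
    rw [hv0]
    exact X.datum_decay
  have hmem' : MemLqLp q r (fun t x => fderiv ℝ (v t) x) (Ioo 0 X.T) := by
    refine hmem.congr_ae_slice ((ae_restrict_iff' measurableSet_Ioo).2 (ae_of_all _ ?_))
    intro t ht
    have e : v t = X.u t := hvu t ⟨ht.1.le, ht.2⟩
    rw [e]
  exact hmax.2 (BeiraoDaVeiga1995_gradientCriterion_holds ν X.T hν X.T_pos v X.p hmax.1 hLH hdec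
    q r h1q hq hqr hmem')

/-! ## §5 Miller's middle eigenvalue of the strain -/

/-- **MILLER'S MIDDLE-EIGENVALUE CRITERION FOR EVERY UNFORCED CLAY BLOW-UP** (`ν > 0`, `f = 0`;
no named fact): if a nonnegative `m(t, x)` dominates the quadratic form of `∇u(t, x)` on SOME
2-plane at every `(t, x) ∈ [0, T) × ℝ³` (i.e. `m ≥ λ₂⁺`, the positive part of the middle eigenvalue of
the strain), then `∫₀ᵀ ‖m(t)‖_{L^q}^{2q/(2q−3)} dt = ∞` for every `q > 3/2` — stated as the negation of
the finiteness hypothesis of the tree theorem `Miller2019.middleEigenvalueCriterion_holds`, applied to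
the maximal Leray–Hopf completion. [cite: Miller2019, Thm 1.1] -/
theorem middleEigenvalue_not_integrable (hν : 0 < ν) (hf : X.f = 0) {q : ℝ} (hq : 3 / 2 < q)
    {m : ℝ → EuclideanSpace ℝ (Fin 3) → ℝ} (hm0 : ∀ t x, 0 ≤ m t x)
    (hdom : ∀ t ∈ Ico 0 X.T, ∀ x, ∃ v w : EuclideanSpace ℝ (Fin 3),
      ‖v‖ = 1 ∧ ‖w‖ = 1 ∧ inner ℝ v w = 0 ∧
        ∀ α β : ℝ, inner ℝ (fderiv ℝ (X.u t) x (α • v + β • w)) (α • v + β • w)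
          ≤ m t x * (α ^ 2 + β ^ 2)) :
    ¬ (∫⁻ t in Ioo 0 X.T, (∫⁻ x, ENNReal.ofReal (m t x) ^ q) ^ (2 / (2 * q - 3)) < ⊤) := by
  intro hfin
  obtain ⟨v, hvu, hmax, hLH⟩ := X.exists_maximal_lerayHopf hν hf
  have hv0 : v 0 = X.u 0 := hvu 0 ⟨le_rfl, X.T_pos⟩
  have hdec : HasRapidSpatialDecay (v 0) := by
    rw [hv0]
    exact X.datum_decay
  have hdom' : ∀ t ∈ Ico 0 X.T, ∀ x, ∃ v' w : EuclideanSpace ℝ (Fin 3),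
      ‖v'‖ = 1 ∧ ‖w‖ = 1 ∧ inner ℝ v' w = 0 ∧
        ∀ α β : ℝ, inner ℝ (fderiv ℝ (v t) x (α • v' + β • w)) (α • v' + β • w)
          ≤ m t x * (α ^ 2 + β ^ 2) := by
    intro t ht x
    rw [hvu t ht]
    exact hdom t ht x
  exact hmax.2 (Miller2019.middleEigenvalueCriterion_holds ν X.T hν X.T_pos v X.p hmax.1 hLH hdec q
    hq m hm0 hdom' hfin)

end ClayBlowup

/-! ## §6 The strong type -/

namespace DesignedBlowup

variable {ν : ℝ} (D : DesignedBlowup ν)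

/-- **Beale–Kato–Majda for every unforced designed blow-up.** [cite: BealeKatoMajda1984, Theorem 1] -/
theorem lintegral_vorticity_sup_eq_top (hν : 0 < ν) (hf : D.f = 0) :
    (∫⁻ t in Ioo 0 D.T, ⨆ x, ‖curl (D.u t) x‖ₑ) = ⊤ :=
  D.toClayBlowup.lintegral_vorticity_sup_eq_top hν hf

/-- **Constantin–Fefferman for every unforced designed blow-up.**
[cite: ConstantinFeffermanIndiana1993, Theorem (§1)] -/
theorem vorticityDirection_incoherent (hν : 0 < ν) (hf : D.f = 0) {Ω ρ : ℝ} (hΩ : 0 < Ω)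
    (hρ : 0 < ρ) :
    ∃ t ∈ Ico 0 D.T, ∃ x y : EuclideanSpace ℝ (Fin 3),
      Ω < ‖curl (D.u t) x‖ ∧ Ω < ‖curl (D.u t) y‖ ∧
        ‖x - y‖ / ρ <
          Real.sqrt (1 - inner ℝ (vorticityDirection (curl (D.u t)) x)
            (vorticityDirection (curl (D.u t)) y) ^ 2) :=
  D.toClayBlowup.vorticityDirection_incoherent hν hf hΩ hρ

/-- **Beirão da Veiga for every unforced designed blow-up.** [cite: BerselliGaldi2002, (1.3) p. 3586] -/
theorem gradient_not_memLqLp (hν : 0 < ν) (hf : D.f = 0) {q r : ℝ≥0∞} (h1q : 1 < q) (hq : q < ⊤)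
    (hqr : 2 / q + 3 / r = 2) :
    ¬ MemLqLp q r (fun t x => fderiv ℝ (D.u t) x) (Ioo 0 D.T) :=
  D.toClayBlowup.gradient_not_memLqLp hν hf h1q hq hqr

end DesignedBlowup

end Summit.NavierStokesRegularity.FluidComputer

end
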